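import Summits.CriticalPhenomena.PercolationContinuityZ3.Theorems.PercNearOneGluingNoHeavyLowerTailAntitheticHarris
import Summits.CriticalPhenomena.PercolationContinuityZ3.Theorems.PercNearOneGluingNoHeavyLowerTailAntitheticTopVertex
import HarnessLib

/-!
# `NoHeavyLowerTail` (stmt-CriticalPhenomena-4575) — antithetic cluster pairs: **THE POSITIVE-PART LEMMA** — on every INCREASING event
# each cross-sign part of an antithetic sum is dominated by its aligned part; the DOUBLE-SET diagonal (prim-hp-2 gen 74,
# HOME/THEOREM-W.md, HOME/MEMO-gen74.md)

Support file (`--supports stmt-CriticalPhenomena-4575`, hull-port prover `prim-hp-2`, gen 74).  No definitions, no named facts, no sorries;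
standard axioms.  Notation: colourings `T ⊆ Sym2 V`, edge set `E`, source `s`, `X T = openCluster (T ∩ E) s` (red cluster),
`Y T = openCluster (Tᶜ ∩ E) s` (blue cluster), `D T = X T ∩ Y T` (the DOUBLE SET of `s`); K-form test kernels `K` are TWISTED-MONOTONE
(`P ⊆ P'`, `Q' ⊆ Q` ⇒ `K P Q ≤ K P' Q'`) and SUPER-ODD (`0 ≤ K P Q + K Q P`) — they contain the shifted class
`K(A, B) = F⁺(A) − F⁻(B)` (`F⁻ ≤ F⁺` monotone) and the odd class `F(A) − F(B)`.

MASTER LEMMA (`Antithetic.PosPart.weighted_sum_nonneg`, abstract cube; `…cluster_weighted_sum_nonneg` for clusters).  For every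
NONNEGATIVE INCREASING weight `w` on the colourings and every super-odd twisted-monotone `K`:
   `0 ≤ Σ_T w(T) · K(X T, Y T)`.
(Proof: `k(T) = K(X T, Y T)` is increasing and `k(T) + k(Tᶜ) ≥ 0` by super-oddness, so `Σ k ≥ 0`; centred Harris
`Antithetic.harris_uniform_centred` gives `Σ (w − w̄)(k − k̄) ≥ 0`, i.e. `Σ w k ≥ N w̄ k̄ ≥ 0`.)

THEOREM W — THE POSITIVE-PART LEMMA (`Antithetic.PosPart.posPart_cross_sum_nonneg`, `…posPart_sym_sum_nonneg`,
`…cluster_posPart_sym_sum_nonneg`).  For every increasing event `𝒰` (more generally every nonnegative increasing weight `u`), every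
twisted-monotone `K₁` and every super-odd twisted-monotone `K₂`:
   `0 ≤ Σ_{T ∈ 𝒰} max(K₁(X T, Y T), 0) · K₂(X T, Y T)`        (the weight `𝟙_𝒰 · (K₁)₊` is increasing and nonnegative),
hence, writing `k = k₊ − k₋`,  `Σ_𝒰 (K₁)₊ (K₂)₋ ≤ Σ_𝒰 (K₁)₊ (K₂)₊` and symmetrically `Σ_𝒰 (K₁)₋ (K₂)₊ ≤ Σ_𝒰 (K₁)₊ (K₂)₊`:
**on an up-set each CROSS-SIGN part of the antithetic sum `Σ_𝒰 K₁K₂` is at most the ALIGNED POSITIVE part**, and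
   `Σ_𝒰 K₁ K₂ ≥ Σ_𝒰 (K₁)₋(K₂)₋ − Σ_𝒰 (K₁)₊(K₂)₊`      (`…cluster_upset_sum_ge`).
COROLLARIES (odd class `F, G` monotone; `…upset_double_diag_sum_nonneg`): since `0 ≤ (F(X) − F(Y))₊ ≤ F(X) − F(X ∩ Y) ≤ F(X) − F{s}`,
   `0 ≤ Σ_𝒰 [ (F(X) − F(Y))(G(X) − G(Y)) + (F(X) − F(X∩Y))(G(X) − G(X∩Y)) ]`     — THEOREM U (…AntitheticUpsetDiag, gen 73) with the
anchor `{s}` replaced by the whole DOUBLE SET `X ∩ Y ⊇ {s}` (a smaller diagonal correction); and in the shifted class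
(`…upset_double_shift_sum_nonneg`)  `0 ≤ Σ_𝒰 [ (F⁺X − F⁻Y)(G⁺X − G⁻Y) + (F⁺X − F⁻(X∩Y))(G⁺X − G⁻(X∩Y)) ]`.
Numerically (HOME/MEMO-gen74.md §1): the half-diagonal version of THEOREM U is FALSE (470 of 1 754 ⊕/TOP-negative fan-calculus records), while
the double-set form holds in all of them.
[cite: VandenbergHaggstromKahn2005, §1 p. 6 ("Harris' inequality"), §1 p. 3 (open cluster `C_s`)]
-/

noncomputable section

namespace Summit.CriticalPhenomena.PercolationContinuityZ3.Theorems

open Literature.Probability.Percolation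
open scoped Classical

namespace Antithetic

namespace PosPart

section Cube

variable {ι : Type*} [Fintype ι] {V : Type*}

/-- **Master lemma (abstract cube).**  `Wr` increasing, `Wb` decreasing set-valued functions on the cube `Set ι` with antipodal domination
`Wb Tᶜ ⊆ Wr T`; `K` twisted-monotone and super-odd; `w ≥ 0` increasing.  Then `0 ≤ Σ_T w T · K (Wr T) (Wb T)`. [this work] -/
theorem weighted_sum_nonneg (Wr Wb : Set ι → Set V) (hWr : Monotone Wr) (hWb : Antitone Wb)
    (hdom : ∀ T, Wb Tᶜ ⊆ Wr T) {K : Set V → Set V → ℝ}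
    (hK : ∀ ⦃P P' Q Q' : Set V⦄, P ⊆ P' → Q' ⊆ Q → K P Q ≤ K P' Q') (hso : ∀ P Q, 0 ≤ K P Q + K Q P)
    {w : Set ι → ℝ} (hw0 : ∀ T, 0 ≤ w T) (hw : Monotone w) :
    0 ≤ ∑ T : Set ι, w T * K (Wr T) (Wb T) := by
  let k : Set ι → ℝ := fun T => K (Wr T) (Wb T)
  show 0 ≤ ∑ T : Set ι, w T * k T
  have hk : Monotone k := fun T T' h => hK (hWr h) (hWb h)
  -- antipodal pairs have nonnegative sum
  have hpair : ∀ T, 0 ≤ k T + k Tᶜ := by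
    intro T
    have hA : Wb T ⊆ Wr Tᶜ := by simpa only [compl_compl] using hdom Tᶜ
    have h1 : K (Wb T) (Wr T) ≤ k Tᶜ := hK hA (hdom T)
    have h2 := hso (Wr T) (Wb T)
    show 0 ≤ K (Wr T) (Wb T) + K (Wr Tᶜ) (Wb Tᶜ)
    linarith
  have hsumc : ∀ c : Set ι → ℝ, ∑ T : Set ι, c Tᶜ = ∑ T : Set ι, c T := fun c =>
    Fintype.sum_equiv (Equiv.mk compl compl compl_compl compl_compl) _ _ fun T => rfl
  have hksum : 0 ≤ ∑ T : Set ι, k T := by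
    have h1 : 2 * ∑ T : Set ι, k T = ∑ T : Set ι, (k T + k Tᶜ) := by
      rw [Finset.sum_add_distrib, hsumc k]; ring
    have h2 : 0 ≤ ∑ T : Set ι, (k T + k Tᶜ) := Finset.sum_nonneg fun T _ => hpair T
    linarith
  -- centre `w` and `k`
  set N : ℝ := (Fintype.card (Set ι) : ℝ) with hN
  have hNpos : (0 : ℝ) < N := by
    rw [hN]; exact_mod_cast Fintype.card_pos
  set Sw : ℝ := ∑ T : Set ι, w T with hSw
  set Sk : ℝ := ∑ T : Set ι, k T with hSk
  have hSw0 : 0 ≤ Sw := Finset.sum_nonneg fun T _ => hw0 T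
  let a : Set ι → ℝ := fun T => w T - Sw / N
  let b : Set ι → ℝ := fun T => k T - Sk / N
  have ha : Monotone a := fun T T' h => sub_le_sub_right (hw h) _
  have hb : Monotone b := fun T T' h => sub_le_sub_right (hk h) _
  have ha0 : ∑ T : Set ι, a T = 0 := by
    simp only [a]
    rw [Finset.sum_sub_distrib, Finset.sum_const, Finset.card_univ, nsmul_eq_mul]
    rw [← hN, ← hSw]
    field_simp
    ring
  have hb0 : ∑ T : Set ι, b T = 0 := by
    simp only [b]
    rw [Finset.sum_sub_distrib, Finset.sum_const, Finset.card_univ, nsmul_eq_mul]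
    rw [← hN, ← hSk]
    field_simp
    ring
  have hcen := harris_uniform_centred ha hb ha0 hb0
  have hexp : ∑ T : Set ι, a T * b T = ∑ T : Set ι, w T * k T - Sw * Sk / N := by
    have h1 : ∀ T, a T * b T = w T * k T - (Sk / N) * w T - (Sw / N) * k T + (Sw / N) * (Sk / N) := fun T => by
      simp only [a, b]; ring
    simp_rw [h1]
    rw [Finset.sum_add_distrib, Finset.sum_sub_distrib, Finset.sum_sub_distrib, ← Finset.mul_sum, ← Finset.mul_sum,
      Finset.sum_const, Finset.card_univ, nsmul_eq_mul, ← hN, ← hSw, ← hSk]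
    field_simp
    ring
  rw [hexp] at hcen
  have hprod : 0 ≤ Sw * Sk / N := div_nonneg (mul_nonneg hSw0 hksum) hNpos.le
  linarith

/-- **THEOREM W, one-sided (abstract cube).**  `u ≥ 0` increasing (the event weight), `K₁` twisted-monotone, `K₂` twisted-monotone and
super-odd.  Then `0 ≤ Σ_T u T · max(K₁,0) · K₂`: the cross-sign part `Σ u (K₁)₊(K₂)₋` is at most the aligned part `Σ u (K₁)₊(K₂)₊`.
[this work] -/
theorem posPart_cross_sum_nonneg (Wr Wb : Set ι → Set V) (hWr : Monotone Wr) (hWb : Antitone Wb)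
    (hdom : ∀ T, Wb Tᶜ ⊆ Wr T) {K₁ K₂ : Set V → Set V → ℝ}
    (hK₁ : ∀ ⦃P P' Q Q' : Set V⦄, P ⊆ P' → Q' ⊆ Q → K₁ P Q ≤ K₁ P' Q')
    (hK₂ : ∀ ⦃P P' Q Q' : Set V⦄, P ⊆ P' → Q' ⊆ Q → K₂ P Q ≤ K₂ P' Q') (hso₂ : ∀ P Q, 0 ≤ K₂ P Q + K₂ Q P)
    {u : Set ι → ℝ} (hu0 : ∀ T, 0 ≤ u T) (hu : Monotone u) :
    0 ≤ ∑ T : Set ι, u T * (max (K₁ (Wr T) (Wb T)) 0 * K₂ (Wr T) (Wb T)) := by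
  have hw0 : ∀ T, 0 ≤ u T * max (K₁ (Wr T) (Wb T)) 0 := fun T => mul_nonneg (hu0 T) (le_max_right _ _)
  have hw : Monotone fun T => u T * max (K₁ (Wr T) (Wb T)) 0 := fun T T' h =>
    mul_le_mul (hu h) (max_le_max (hK₁ (hWr h) (hWb h)) le_rfl) (le_max_right _ _) (hu0 T')
  have h := weighted_sum_nonneg Wr Wb hWr hWb hdom hK₂ hso₂ hw0 hw
  simpa only [mul_assoc] using h

/-- **THEOREM W, symmetric form (abstract cube).**  `u ≥ 0` increasing, `K₁, K₂` twisted-monotone and super-odd: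
`0 ≤ Σ_T u T · ( max(K₁,0)·K₂ + K₁·max(K₂,0) )`. [this work] -/
theorem posPart_sym_sum_nonneg (Wr Wb : Set ι → Set V) (hWr : Monotone Wr) (hWb : Antitone Wb)
    (hdom : ∀ T, Wb Tᶜ ⊆ Wr T) {K₁ K₂ : Set V → Set V → ℝ}
    (hK₁ : ∀ ⦃P P' Q Q' : Set V⦄, P ⊆ P' → Q' ⊆ Q → K₁ P Q ≤ K₁ P' Q') (hso₁ : ∀ P Q, 0 ≤ K₁ P Q + K₁ Q P)
    (hK₂ : ∀ ⦃P P' Q Q' : Set V⦄, P ⊆ P' → Q' ⊆ Q → K₂ P Q ≤ K₂ P' Q') (hso₂ : ∀ P Q, 0 ≤ K₂ P Q + K₂ Q P)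
    {u : Set ι → ℝ} (hu0 : ∀ T, 0 ≤ u T) (hu : Monotone u) :
    0 ≤ ∑ T : Set ι, u T * (max (K₁ (Wr T) (Wb T)) 0 * K₂ (Wr T) (Wb T) + K₁ (Wr T) (Wb T) * max (K₂ (Wr T) (Wb T)) 0) := by
  have h1 := posPart_cross_sum_nonneg Wr Wb hWr hWb hdom hK₁ hK₂ hso₂ hu0 hu
  have h2 := posPart_cross_sum_nonneg Wr Wb hWr hWb hdom hK₂ hK₁ hso₁ hu0 hu
  have h3 : ∑ T : Set ι, u T * (max (K₁ (Wr T) (Wb T)) 0 * K₂ (Wr T) (Wb T) + K₁ (Wr T) (Wb T) * max (K₂ (Wr T) (Wb T)) 0) =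
      ∑ T : Set ι, u T * (max (K₁ (Wr T) (Wb T)) 0 * K₂ (Wr T) (Wb T)) +
        ∑ T : Set ι, u T * (max (K₂ (Wr T) (Wb T)) 0 * K₁ (Wr T) (Wb T)) := by
    rw [← Finset.sum_add_distrib]
    refine Finset.sum_congr rfl fun T _ => ?_
    ring
  rw [h3]
  exact add_nonneg h1 h2

/-- **THEOREM W as a lower bound (abstract cube).**  With `k₊ = max(k,0)`, `k₋ = max(−k,0)`:
`Σ_T u·( (K₁)₋(K₂)₋ − (K₁)₊(K₂)₊ ) ≤ Σ_T u·K₁K₂` — an increasing-event antithetic sum is never below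
"both-negative mass minus both-positive mass". [this work] -/
theorem sum_ge_negParts_sub_posParts (Wr Wb : Set ι → Set V) (hWr : Monotone Wr) (hWb : Antitone Wb)
    (hdom : ∀ T, Wb Tᶜ ⊆ Wr T) {K₁ K₂ : Set V → Set V → ℝ}
    (hK₁ : ∀ ⦃P P' Q Q' : Set V⦄, P ⊆ P' → Q' ⊆ Q → K₁ P Q ≤ K₁ P' Q') (hso₁ : ∀ P Q, 0 ≤ K₁ P Q + K₁ Q P)
    (hK₂ : ∀ ⦃P P' Q Q' : Set V⦄, P ⊆ P' → Q' ⊆ Q → K₂ P Q ≤ K₂ P' Q') (hso₂ : ∀ P Q, 0 ≤ K₂ P Q + K₂ Q P)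
    {u : Set ι → ℝ} (hu0 : ∀ T, 0 ≤ u T) (hu : Monotone u) :
    ∑ T : Set ι, u T * (max (-K₁ (Wr T) (Wb T)) 0 * max (-K₂ (Wr T) (Wb T)) 0 -
        max (K₁ (Wr T) (Wb T)) 0 * max (K₂ (Wr T) (Wb T)) 0) ≤
      ∑ T : Set ι, u T * (K₁ (Wr T) (Wb T) * K₂ (Wr T) (Wb T)) := by
  have h := posPart_sym_sum_nonneg Wr Wb hWr hWb hdom hK₁ hso₁ hK₂ hso₂ hu0 hu
  rw [← sub_nonneg, ← Finset.sum_sub_distrib]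
  refine h.trans (le_of_eq (Finset.sum_congr rfl fun T _ => ?_))
  -- pointwise identity `k₁₊ k₂ + k₁ k₂₊ = k₁k₂ − (k₁₋k₂₋ − k₁₊k₂₊)`
  set x := K₁ (Wr T) (Wb T)
  set y := K₂ (Wr T) (Wb T)
  rcases le_total x 0 with hx | hx <;> rcases le_total y 0 with hy | hy
  · rw [max_eq_right hx, max_eq_right hy, max_eq_left (neg_nonneg.2 hx), max_eq_left (neg_nonneg.2 hy)]; ring
  · rw [max_eq_right hx, max_eq_left hy, max_eq_left (neg_nonneg.2 hx), max_eq_right (neg_nonpos.2 hy)]; ring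
  · rw [max_eq_left hx, max_eq_right hy, max_eq_right (neg_nonpos.2 hx), max_eq_left (neg_nonneg.2 hy)]; ring
  · rw [max_eq_left hx, max_eq_left hy, max_eq_right (neg_nonpos.2 hx), max_eq_right (neg_nonpos.2 hy)]; ring

end Cube

section Clusters

variable {V : Type*} [Fintype V]

/-- **Master lemma for clusters.**  For every finite edge set `E`, source `s`, every nonnegative increasing weight `w` on colourings and
every super-odd twisted-monotone `K`: `0 ≤ Σ_T w T · K (X T) (Y T)`. [this work] -/
theorem cluster_weighted_sum_nonneg (E : Set (Sym2 V)) (s : V) {K : Set V → Set V → ℝ}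
    (hK : ∀ ⦃P P' Q Q' : Set V⦄, P ⊆ P' → Q' ⊆ Q → K P Q ≤ K P' Q') (hso : ∀ P Q, 0 ≤ K P Q + K Q P)
    {w : Set (Sym2 V) → ℝ} (hw0 : ∀ T, 0 ≤ w T) (hw : Monotone w) :
    0 ≤ ∑ T : Set (Sym2 V), w T * K (openCluster (T ∩ E) s) (openCluster (Tᶜ ∩ E) s) := by
  refine weighted_sum_nonneg (fun T : Set (Sym2 V) => openCluster (T ∩ E) s) (fun T => openCluster (Tᶜ ∩ E) s)
    (fun T T' h => Freeze.openCluster_mono (Set.inter_subset_inter_left E h) s)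
    (fun T T' h => Freeze.openCluster_mono (Set.inter_subset_inter_left E (Set.compl_subset_compl.2 h)) s)
    (fun T => ?_) hK hso hw0 hw
  simp only [compl_compl]
  exact le_rfl

/-- **THEOREM W for clusters (positive-part lemma).**  For every finite edge set `E`, source `s`, every INCREASING event `𝒰` of
colourings and all super-odd twisted-monotone `K₁, K₂`:
`0 ≤ Σ_{T ∈ 𝒰} [ max(K₁(X T, Y T), 0)·K₂(X T, Y T) + K₁(X T, Y T)·max(K₂(X T, Y T), 0) ]` — on an up-set each cross-sign part of the
antithetic sum is at most the aligned positive part. [this work] -/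
theorem cluster_posPart_sym_sum_nonneg (E : Set (Sym2 V)) (s : V) (U : Set (Sym2 V) → Prop) [DecidablePred U]
    (hU : ∀ ⦃T T' : Set (Sym2 V)⦄, T ⊆ T' → U T → U T') {K₁ K₂ : Set V → Set V → ℝ}
    (hK₁ : ∀ ⦃P P' Q Q' : Set V⦄, P ⊆ P' → Q' ⊆ Q → K₁ P Q ≤ K₁ P' Q') (hso₁ : ∀ P Q, 0 ≤ K₁ P Q + K₁ Q P)
    (hK₂ : ∀ ⦃P P' Q Q' : Set V⦄, P ⊆ P' → Q' ⊆ Q → K₂ P Q ≤ K₂ P' Q') (hso₂ : ∀ P Q, 0 ≤ K₂ P Q + K₂ Q P) :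
    0 ≤ ∑ T ∈ Finset.univ.filter U,
      (max (K₁ (openCluster (T ∩ E) s) (openCluster (Tᶜ ∩ E) s)) 0 * K₂ (openCluster (T ∩ E) s) (openCluster (Tᶜ ∩ E) s) +
        K₁ (openCluster (T ∩ E) s) (openCluster (Tᶜ ∩ E) s) * max (K₂ (openCluster (T ∩ E) s) (openCluster (Tᶜ ∩ E) s)) 0) := by
  let u : Set (Sym2 V) → ℝ := fun T => if U T then 1 else 0
  have hu0 : ∀ T, 0 ≤ u T := fun T => by simp only [u]; split_ifs <;> norm_num
  have hu : Monotone u := by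
    intro T T' h
    simp only [u]
    by_cases hT : U T
    · rw [if_pos hT, if_pos (hU h hT)]
    · rw [if_neg hT]; split_ifs <;> norm_num
  have h := posPart_sym_sum_nonneg (fun T : Set (Sym2 V) => openCluster (T ∩ E) s) (fun T => openCluster (Tᶜ ∩ E) s)
    (fun T T' h => Freeze.openCluster_mono (Set.inter_subset_inter_left E h) s)
    (fun T T' h => Freeze.openCluster_mono (Set.inter_subset_inter_left E (Set.compl_subset_compl.2 h)) s)
    (fun T => by simp only [compl_compl]; exact le_rfl) hK₁ hso₁ hK₂ hso₂ hu0 hu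
  rw [Finset.sum_filter]
  refine h.trans (le_of_eq (Finset.sum_congr rfl fun T _ => ?_))
  simp only [u]
  split_ifs <;> simp

/-- **THEOREM W as a lower bound for clusters.**  For every increasing event `𝒰` and super-odd twisted-monotone `K₁, K₂`:
`Σ_{T ∈ 𝒰} [ (K₁)₋(K₂)₋ − (K₁)₊(K₂)₊ ] ≤ Σ_{T ∈ 𝒰} K₁K₂` (all kernels evaluated at `(X T, Y T)`). [this work] -/
theorem cluster_upset_sum_ge (E : Set (Sym2 V)) (s : V) (U : Set (Sym2 V) → Prop) [DecidablePred U]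
    (hU : ∀ ⦃T T' : Set (Sym2 V)⦄, T ⊆ T' → U T → U T') {K₁ K₂ : Set V → Set V → ℝ}
    (hK₁ : ∀ ⦃P P' Q Q' : Set V⦄, P ⊆ P' → Q' ⊆ Q → K₁ P Q ≤ K₁ P' Q') (hso₁ : ∀ P Q, 0 ≤ K₁ P Q + K₁ Q P)
    (hK₂ : ∀ ⦃P P' Q Q' : Set V⦄, P ⊆ P' → Q' ⊆ Q → K₂ P Q ≤ K₂ P' Q') (hso₂ : ∀ P Q, 0 ≤ K₂ P Q + K₂ Q P) :
    ∑ T ∈ Finset.univ.filter U,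
      (max (-K₁ (openCluster (T ∩ E) s) (openCluster (Tᶜ ∩ E) s)) 0 * max (-K₂ (openCluster (T ∩ E) s) (openCluster (Tᶜ ∩ E) s)) 0 -
        max (K₁ (openCluster (T ∩ E) s) (openCluster (Tᶜ ∩ E) s)) 0 * max (K₂ (openCluster (T ∩ E) s) (openCluster (Tᶜ ∩ E) s)) 0) ≤
    ∑ T ∈ Finset.univ.filter U,
      K₁ (openCluster (T ∩ E) s) (openCluster (Tᶜ ∩ E) s) * K₂ (openCluster (T ∩ E) s) (openCluster (Tᶜ ∩ E) s) := by
  let u : Set (Sym2 V) → ℝ := fun T => if U T then 1 else 0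
  have hu0 : ∀ T, 0 ≤ u T := fun T => by simp only [u]; split_ifs <;> norm_num
  have hu : Monotone u := by
    intro T T' h
    simp only [u]
    by_cases hT : U T
    · rw [if_pos hT, if_pos (hU h hT)]
    · rw [if_neg hT]; split_ifs <;> norm_num
  have h := sum_ge_negParts_sub_posParts (fun T : Set (Sym2 V) => openCluster (T ∩ E) s) (fun T => openCluster (Tᶜ ∩ E) s)
    (fun T T' h => Freeze.openCluster_mono (Set.inter_subset_inter_left E h) s)
    (fun T T' h => Freeze.openCluster_mono (Set.inter_subset_inter_left E (Set.compl_subset_compl.2 h)) s)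
    (fun T => by simp only [compl_compl]; exact le_rfl) hK₁ hso₁ hK₂ hso₂ hu0 hu
  rw [Finset.sum_filter, Finset.sum_filter]
  have e1 : ∀ (Ψ : Set (Sym2 V) → ℝ), ∑ T : Set (Sym2 V), (if U T then Ψ T else 0) = ∑ T : Set (Sym2 V), u T * Ψ T := by
    intro Ψ
    refine Finset.sum_congr rfl fun T _ => ?_
    simp only [u]
    split_ifs <;> simp
  rw [e1, e1]
  exact h

/-- **The double-set diagonal (odd class).**  For every finite edge set `E`, source `s`, increasing event `𝒰` and all monotone `F, G`:
`0 ≤ Σ_{T ∈ 𝒰} [ (F(X T) − F(Y T))(G(X T) − G(Y T)) + (F(X T) − F(X T ∩ Y T))(G(X T) − G(X T ∩ Y T)) ]` — THEOREM U with the anchor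
`{s}` replaced by the double set `X ∩ Y`.  (From THEOREM W: `(F X − F Y)₊ ≤ F X − F(X ∩ Y)` and `F X − F(X ∩ Y) ≥ 0`.) [this work] -/
theorem upset_double_diag_sum_nonneg (E : Set (Sym2 V)) (s : V) (U : Set (Sym2 V) → Prop) [DecidablePred U]
    (hU : ∀ ⦃T T' : Set (Sym2 V)⦄, T ⊆ T' → U T → U T') (F G : Set V → ℝ) (hF : Monotone F) (hG : Monotone G) :
    0 ≤ ∑ T ∈ Finset.univ.filter U,
      ((F (openCluster (T ∩ E) s) - F (openCluster (Tᶜ ∩ E) s)) * (G (openCluster (T ∩ E) s) - G (openCluster (Tᶜ ∩ E) s)) +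
        (F (openCluster (T ∩ E) s) - F (openCluster (T ∩ E) s ∩ openCluster (Tᶜ ∩ E) s)) *
          (G (openCluster (T ∩ E) s) - G (openCluster (T ∩ E) s ∩ openCluster (Tᶜ ∩ E) s))) := by
  have hK₁ : ∀ ⦃P P' Q Q' : Set V⦄, P ⊆ P' → Q' ⊆ Q → F P - F Q ≤ F P' - F Q' := fun P P' Q Q' h1 h2 => sub_le_sub (hF h1) (hF h2)
  have hK₂ : ∀ ⦃P P' Q Q' : Set V⦄, P ⊆ P' → Q' ⊆ Q → G P - G Q ≤ G P' - G Q' := fun P P' Q Q' h1 h2 => sub_le_sub (hG h1) (hG h2)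
  have hso₁ : ∀ P Q : Set V, 0 ≤ F P - F Q + (F Q - F P) := fun P Q => by linarith
  have hso₂ : ∀ P Q : Set V, 0 ≤ G P - G Q + (G Q - G P) := fun P Q => by linarith
  have h := cluster_upset_sum_ge E s U hU hK₁ hso₁ hK₂ hso₂
  -- compare termwise: `k₁₋k₂₋ − k₁₊k₂₊ ≥ −(F X − F D)(G X − G D)`
  have hle : ∑ T ∈ Finset.univ.filter U,
      -((F (openCluster (T ∩ E) s) - F (openCluster (T ∩ E) s ∩ openCluster (Tᶜ ∩ E) s)) *
          (G (openCluster (T ∩ E) s) - G (openCluster (T ∩ E) s ∩ openCluster (Tᶜ ∩ E) s))) ≤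
      ∑ T ∈ Finset.univ.filter U,
      (max (-(F (openCluster (T ∩ E) s) - F (openCluster (Tᶜ ∩ E) s))) 0 * max (-(G (openCluster (T ∩ E) s) - G (openCluster (Tᶜ ∩ E) s))) 0 -
        max (F (openCluster (T ∩ E) s) - F (openCluster (Tᶜ ∩ E) s)) 0 * max (G (openCluster (T ∩ E) s) - G (openCluster (Tᶜ ∩ E) s)) 0) := by
    refine Finset.sum_le_sum fun T _ => ?_
    set X := openCluster (T ∩ E) s
    set Y := openCluster (Tᶜ ∩ E) s
    have hDX : X ∩ Y ⊆ X := Set.inter_subset_left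
    have hDY : X ∩ Y ⊆ Y := Set.inter_subset_right
    have hF1 : max (F X - F Y) 0 ≤ F X - F (X ∩ Y) := max_le (sub_le_sub_left (hF hDY) _) (sub_nonneg.2 (hF hDX))
    have hG1 : max (G X - G Y) 0 ≤ G X - G (X ∩ Y) := max_le (sub_le_sub_left (hG hDY) _) (sub_nonneg.2 (hG hDX))
    have hprod : max (F X - F Y) 0 * max (G X - G Y) 0 ≤ (F X - F (X ∩ Y)) * (G X - G (X ∩ Y)) :=
      mul_le_mul hF1 hG1 (le_max_right _ _) ((le_max_right _ _).trans hF1)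
    have hnn : 0 ≤ max (-(F X - F Y)) 0 * max (-(G X - G Y)) 0 := mul_nonneg (le_max_right _ _) (le_max_right _ _)
    linarith
  have hsum : ∑ T ∈ Finset.univ.filter U,
      ((F (openCluster (T ∩ E) s) - F (openCluster (Tᶜ ∩ E) s)) * (G (openCluster (T ∩ E) s) - G (openCluster (Tᶜ ∩ E) s)) +
        (F (openCluster (T ∩ E) s) - F (openCluster (T ∩ E) s ∩ openCluster (Tᶜ ∩ E) s)) *
          (G (openCluster (T ∩ E) s) - G (openCluster (T ∩ E) s ∩ openCluster (Tᶜ ∩ E) s))) =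
      ∑ T ∈ Finset.univ.filter U,
        (F (openCluster (T ∩ E) s) - F (openCluster (Tᶜ ∩ E) s)) * (G (openCluster (T ∩ E) s) - G (openCluster (Tᶜ ∩ E) s)) -
      ∑ T ∈ Finset.univ.filter U,
        -((F (openCluster (T ∩ E) s) - F (openCluster (T ∩ E) s ∩ openCluster (Tᶜ ∩ E) s)) *
          (G (openCluster (T ∩ E) s) - G (openCluster (T ∩ E) s ∩ openCluster (Tᶜ ∩ E) s))) := by
    rw [← Finset.sum_sub_distrib]
    refine Finset.sum_congr rfl fun T _ => ?_
    ring
  rw [hsum]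
  linarith

/-- **The double-set form in the shifted class.**  For every increasing event `𝒰` and all monotone `F⁻ ≤ F⁺`, `G⁻ ≤ G⁺`:
`0 ≤ Σ_{T ∈ 𝒰} [ (F⁺(X T) − F⁻(Y T))(G⁺(X T) − G⁻(Y T)) + (F⁺(X T) − F⁻(X T ∩ Y T))(G⁺(X T) − G⁻(X T ∩ Y T)) ]`
(THEOREM W plus `(F⁺X − F⁻Y)₊ ≤ F⁺X − F⁻(X∩Y)`, both factors of the correction being nonnegative). [this work] -/
theorem upset_double_shift_sum_nonneg (E : Set (Sym2 V)) (s : V) (U : Set (Sym2 V) → Prop) [DecidablePred U]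
    (hU : ∀ ⦃T T' : Set (Sym2 V)⦄, T ⊆ T' → U T → U T')
    (Fp Fm Gp Gm : Set V → ℝ) (hFp : Monotone Fp) (hFm : Monotone Fm) (hF : ∀ S, Fm S ≤ Fp S)
    (hGp : Monotone Gp) (hGm : Monotone Gm) (hG : ∀ S, Gm S ≤ Gp S) :
    0 ≤ ∑ T ∈ Finset.univ.filter U,
      ((Fp (openCluster (T ∩ E) s) - Fm (openCluster (Tᶜ ∩ E) s)) * (Gp (openCluster (T ∩ E) s) - Gm (openCluster (Tᶜ ∩ E) s)) +
        (Fp (openCluster (T ∩ E) s) - Fm (openCluster (T ∩ E) s ∩ openCluster (Tᶜ ∩ E) s)) *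
          (Gp (openCluster (T ∩ E) s) - Gm (openCluster (T ∩ E) s ∩ openCluster (Tᶜ ∩ E) s))) := by
  have hK₁ : ∀ ⦃P P' Q Q' : Set V⦄, P ⊆ P' → Q' ⊆ Q → Fp P - Fm Q ≤ Fp P' - Fm Q' :=
    fun P P' Q Q' h1 h2 => sub_le_sub (hFp h1) (hFm h2)
  have hK₂ : ∀ ⦃P P' Q Q' : Set V⦄, P ⊆ P' → Q' ⊆ Q → Gp P - Gm Q ≤ Gp P' - Gm Q' :=
    fun P P' Q Q' h1 h2 => sub_le_sub (hGp h1) (hGm h2)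
  have hso₁ : ∀ P Q : Set V, 0 ≤ Fp P - Fm Q + (Fp Q - Fm P) := fun P Q => by
    have := hF P; have := hF Q; linarith
  have hso₂ : ∀ P Q : Set V, 0 ≤ Gp P - Gm Q + (Gp Q - Gm P) := fun P Q => by
    have := hG P; have := hG Q; linarith
  have h := cluster_upset_sum_ge E s U hU hK₁ hso₁ hK₂ hso₂
  have hle : ∑ T ∈ Finset.univ.filter U,
      -((Fp (openCluster (T ∩ E) s) - Fm (openCluster (T ∩ E) s ∩ openCluster (Tᶜ ∩ E) s)) *
          (Gp (openCluster (T ∩ E) s) - Gm (openCluster (T ∩ E) s ∩ openCluster (Tᶜ ∩ E) s))) ≤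
      ∑ T ∈ Finset.univ.filter U,
      (max (-(Fp (openCluster (T ∩ E) s) - Fm (openCluster (Tᶜ ∩ E) s))) 0 * max (-(Gp (openCluster (T ∩ E) s) - Gm (openCluster (Tᶜ ∩ E) s))) 0 -
        max (Fp (openCluster (T ∩ E) s) - Fm (openCluster (Tᶜ ∩ E) s)) 0 * max (Gp (openCluster (T ∩ E) s) - Gm (openCluster (Tᶜ ∩ E) s)) 0) := by
    refine Finset.sum_le_sum fun T _ => ?_
    set X := openCluster (T ∩ E) s
    set Y := openCluster (Tᶜ ∩ E) s
    have hDX : X ∩ Y ⊆ X := Set.inter_subset_left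
    have hDY : X ∩ Y ⊆ Y := Set.inter_subset_right
    have hF0 : 0 ≤ Fp X - Fm (X ∩ Y) := sub_nonneg.2 ((hF _).trans (hFp hDX))
    have hG0 : 0 ≤ Gp X - Gm (X ∩ Y) := sub_nonneg.2 ((hG _).trans (hGp hDX))
    have hF1 : max (Fp X - Fm Y) 0 ≤ Fp X - Fm (X ∩ Y) := max_le (sub_le_sub_left (hFm hDY) _) hF0
    have hG1 : max (Gp X - Gm Y) 0 ≤ Gp X - Gm (X ∩ Y) := max_le (sub_le_sub_left (hGm hDY) _) hG0
    have hprod : max (Fp X - Fm Y) 0 * max (Gp X - Gm Y) 0 ≤ (Fp X - Fm (X ∩ Y)) * (Gp X - Gm (X ∩ Y)) :=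
      mul_le_mul hF1 hG1 (le_max_right _ _) hF0
    have hnn : 0 ≤ max (-(Fp X - Fm Y)) 0 * max (-(Gp X - Gm Y)) 0 := mul_nonneg (le_max_right _ _) (le_max_right _ _)
    linarith
  have hsum : ∑ T ∈ Finset.univ.filter U,
      ((Fp (openCluster (T ∩ E) s) - Fm (openCluster (Tᶜ ∩ E) s)) * (Gp (openCluster (T ∩ E) s) - Gm (openCluster (Tᶜ ∩ E) s)) +
        (Fp (openCluster (T ∩ E) s) - Fm (openCluster (T ∩ E) s ∩ openCluster (Tᶜ ∩ E) s)) *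
          (Gp (openCluster (T ∩ E) s) - Gm (openCluster (T ∩ E) s ∩ openCluster (Tᶜ ∩ E) s))) =
      ∑ T ∈ Finset.univ.filter U,
        (Fp (openCluster (T ∩ E) s) - Fm (openCluster (Tᶜ ∩ E) s)) * (Gp (openCluster (T ∩ E) s) - Gm (openCluster (Tᶜ ∩ E) s)) -
      ∑ T ∈ Finset.univ.filter U,
        -((Fp (openCluster (T ∩ E) s) - Fm (openCluster (T ∩ E) s ∩ openCluster (Tᶜ ∩ E) s)) *
          (Gp (openCluster (T ∩ E) s) - Gm (openCluster (T ∩ E) s ∩ openCluster (Tᶜ ∩ E) s))) := by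
    rw [← Finset.sum_sub_distrib]
    refine Finset.sum_congr rfl fun T _ => ?_
    ring
  rw [hsum]
  linarith

end Clusters

end PosPart

end Antithetic

end Summit.CriticalPhenomena.PercolationContinuityZ3.Theorems
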